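import Literature.AnabelianGeometry.EtaleTheta.Discharge.Sec4MuTorsionThetaTwistTower
import Literature.AnabelianGeometry.EtaleTheta.Discharge.Sec4Prop42iiiThetaTwistTower
import HarnessLib

/-!
# [EtTh] Def. 4.1 (iv) / Prop. 4.2 (iii) at the FOURTH tower model: the LEVEL-WISE `μ_K`-saturation law `hsat` HOLDS — every object over
# a covering of level `n ≥ m` whose stabilisers have trivial index-`m` cyclotomic character is `μ_K`-saturated for all `K ∣ N_m = (m+1)!`
# — and the one-term knit: [EtTh] Prop. 4.2 (iii) AS TYPED at the canonical §4 model over the fourth tower, displayed Galois datum only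

S. Mochizuki, *The étale theta function …*, Publ. RIMS **45** (2009) [MochizukiEtTh2009], §1 p.13 («`K_N := K(ζ_N, …)`»), Def. 4.1 (iv)
PDF p.87 («`μ_N`-saturated»), Prop. 4.2 (iii) PDF pp.88–90. [cite: MochizukiEtTh2009, Prop 4.2 (iii) p.88]

PROOF-ONLY (theorems only; abc-iut cell, layer L2, seat abc-iut-L2-d2 gen 7; abc-iut-L2-lead R1114/R1178/R1184: the `hsat` producer of
abc-iut-w6-d037's `prop42_iii_of_levelSaturation` (p499861) is this seat's «MU-TORSION@FOURTH-MODEL» (M3), `Sec4MuTorsionThetaTwistTower.lean`).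
* §1 the CHARACTER ADAPTER: for `m ≤ n`, an element of «GRP₃′» whose index-`m` character coordinate is `1` FIXES the level-`n` constant
  `ζ_{N_m} := (N_n/N_m mod N_n, 1)` — the image of the level-`m` generator (`c_n ≡ c_m = 1 (mod M_m)`, `N_m ∣ M_m`, `N_m ∣ N_n`) — whose
  root of unity has order EXACTLY `N_m` (`orderOf_zetaImage`, `actFn_zetaImage_eq_of_right_eq_one`).
* §2 **`levelSaturation R S`** = abc-iut-w6-d037's law `hsat` VERBATIM: `K ∣ N_m`, `m ≤ lvl(A^bs)`, `χ_m(Stab) = 1` ⇒ `IsMuSaturated A K`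
  (MU-TORSION's `isMuSaturated_of_fixed` at the fixed value `ζ_{N_m}`).
* §3 the KNIT **`prop42_iii R S X gS gSs A₀ hA₀ hA₀' hS`** — [EtTh] Prop. 4.2 (iii) AS TYPED (`BiKummerSetting.Prop42_iii`) at the canonical
  §4 model over the fourth tower model, for every free tempered arithmetic group `X` and Galois action `gS`, the ONLY displayed binder being
  the Def. 4.1 (ii) naturality datum `hS` of that free Galois action (print's Galois structure of `B^temp(Π^tp_X)⁰`; at a GENUINE base it is
  abc-iut-L2-t3's `(J3a)` theorem) — the first POSITIVE instance cell of `EtTh:Prop4.2(iii)` (abc-iut-L2-lead R1035 reading) modulo `hS`.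
HONEST FRAMING: class-(b) design model (NOT the tempered Frobenioid of a Tate curve); `X`, `gS` free; nothing here bears on [IUTchIII]
Cor. 3.12; no side taken; typed ≠ proved for anything else.
-/

noncomputable section

namespace Literature.AnabelianGeometry.EtaleTheta

open CategoryTheory Opposite Function Literature.AlgebraicGeometry.Frobenioids Literature.AlgebraicGeometry.Frobenioids.QuasiTemperoid
  Literature.AnabelianGeometry.SemiGraphs LogDivisorModel LogDivisorModel.GaloisAction LogDivisorTower

namespace ThetaTwistTowerTempered

open LogDivisorModel.TateTowerThetaTwist TateTowerKummerTwistRShear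
open TateTowerKummerTwist (M N N_dvd_M N_dvd_N)

/-! ## §1 The character adapter: `χ_m(g) = 1` ⇒ `g` fixes `ζ_{N_m}` read at any level `n ≥ m` -/

section Level

variable {m n : ℕ} (hmn : m ≤ n)

include hmn in
/-- `N_n ∣ M_m · (N_n / N_m)` for `m ≤ n` (`N_m ∣ M_m`). [cite: MochizukiEtTh2009, Def 3.3 (ii) p.73] -/
theorem N_dvd_M_mul_div : ((N n : ℕ+) : ℕ) ∣ M m * (((N n : ℕ+) : ℕ) / ((N m : ℕ+) : ℕ)) := by
  obtain ⟨t, ht⟩ := N_dvd_M m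
  refine ⟨t, ?_⟩
  rw [ht, mul_comm _ t, mul_assoc, Nat.mul_div_cancel' (N_dvd_N hmn), mul_comm]

include hmn in
/-- **The image `N_n/N_m mod N_n` of the level-`m` generator has additive order EXACTLY `N_m` in `ℤ/N_n`.** [cite: MochizukiEtTh2009, §1 p.13] -/
theorem orderOf_zetaImage :
    orderOf (Multiplicative.ofAdd ((((N n : ℕ+) : ℕ) / ((N m : ℕ+) : ℕ) : ℕ) : ZMod (N n))) = ((N m : ℕ+) : ℕ) := by
  rw [orderOf_ofAdd_eq_addOrderOf, ZMod.addOrderOf_coe _ (PNat.ne_zero _), Nat.gcd_eq_right (Nat.div_dvd_of_dvd (N_dvd_N hmn)),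
    Nat.div_div_self (N_dvd_N hmn) (PNat.ne_zero _)]

include hmn in
/-- **An element of «GRP₃′» with trivial index-`m` character coordinate multiplies `N_n/N_m mod N_n` trivially at level `n`**
(compatibility `c_n ≡ c_m = 1 (mod M_m)` and `N_n ∣ M_m · N_n/N_m`). [cite: MochizukiEtTh2009, §1 p.13] -/
theorem castHom_mul_zetaImage_eq (g : Compat 3 thetaShear) (hg : (g : Grp 3 thetaShear).right.1 m = 1) :
    ZMod.castHom (N_dvd_M n) (ZMod (N n)) (((g : Grp 3 thetaShear).right.1 n : (ZMod (M n))ˣ) : ZMod (M n)) *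
        ((((N n : ℕ+) : ℕ) / ((N m : ℕ+) : ℕ) : ℕ) : ZMod (N n)) =
      ((((N n : ℕ+) : ℕ) / ((N m : ℕ+) : ℕ) : ℕ) : ZMod (N n)) := by
  haveI : NeZero (M n) := ⟨Nat.factorial_ne_zero _⟩
  set u : ZMod (M n) := (((g : Grp 3 thetaShear).right.1 n : (ZMod (M n))ˣ) : ZMod (M n)) with hu
  -- `u ≡ 1 (mod M_m)` by compatibility of the character coordinates
  have hum : (u.val : ZMod (M m)) = 1 := by
    have h := congrArg (fun x : (ZMod (M m))ˣ => (x : ZMod (M m))) (resC_right_eq 3 thetaShear g hmn)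
    simp only [hg, Units.val_one, Units.coe_map, RingHom.toMonoidHom_eq_coe, MonoidHom.coe_coe] at h
    rw [← map_natCast (TateTowerKummerTwist.res hmn) u.val, ZMod.natCast_zmod_val]
    exact h
  have hM1 : M m ≠ 1 := Nat.ne_of_gt (Nat.one_lt_factorial.mpr (by omega))
  have hmod : u.val % M m = 1 := by
    have h := (ZMod.natCast_eq_natCast_iff' u.val 1 (M m)).mp (by rw [hum, Nat.cast_one])
    rwa [Nat.one_mod_eq_one.mpr hM1] at h
  have hdecomp : u.val = M m * (u.val / M m) + 1 := by
    conv_lhs => rw [← Nat.div_add_mod u.val (M m), hmod]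
  have hkey : ((M m * (((N n : ℕ+) : ℕ) / ((N m : ℕ+) : ℕ)) : ℕ) : ZMod (N n)) = 0 :=
    (ZMod.natCast_eq_zero_iff _ _).mpr (N_dvd_M_mul_div hmn)
  have hkey' : (M m : ZMod (N n)) * ((((N n : ℕ+) : ℕ) / ((N m : ℕ+) : ℕ) : ℕ) : ZMod (N n)) = 0 := by
    rw [← Nat.cast_mul]
    exact hkey
  rw [← ZMod.natCast_zmod_val u, map_natCast, hdecomp, Nat.cast_add, Nat.cast_mul, Nat.cast_one, add_mul, one_mul,
    mul_comm (M m : ZMod (N n)), mul_assoc, hkey', mul_zero, zero_add]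

include hmn in
/-- **The level-`n` constant `ζ_{N_m} = (N_n/N_m mod N_n, 1)` is FIXED by every element of «GRP₃′» with trivial index-`m` character
coordinate** (it acts on `μ`-valued constants through the character alone, MU-TORSION (M2)). [cite: MochizukiEtTh2009, §1 p.13] -/
theorem actFn_zetaImage_eq_of_right_eq_one (g : Compat 3 thetaShear) (hg : (g : Grp 3 thetaShear).right.1 m = 1) :
    (towerC₃sf.act n).actFn g
        ⟨zeta (TateTowerKummerTwist.MuN n) (Multiplicative.ofAdd ((((N n : ℕ+) : ℕ) / ((N m : ℕ+) : ℕ) : ℕ) : ZMod (N n))), rfl⟩ =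
      ⟨zeta (TateTowerKummerTwist.MuN n) (Multiplicative.ofAdd ((((N n : ℕ+) : ℕ) / ((N m : ℕ+) : ℕ) : ℕ) : ZMod (N n))), rfl⟩ := by
  refine Subtype.ext ?_
  rw [actFn_fst_of_snd_eq_one n g _ rfl]
  refine Prod.ext ?_ rfl
  change levelCharMod n (N n) (N_dvd_M n) (g : Grp 3 thetaShear).right.1
      (Multiplicative.ofAdd ((((N n : ℕ+) : ℕ) / ((N m : ℕ+) : ℕ) : ℕ) : ZMod (N n))) = _
  rw [levelCharMod_apply, toAdd_ofAdd, castHom_mul_zetaImage_eq hmn g hg]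
  rfl

end Level

/-! ## §2 The level-wise saturation law `hsat` at the fourth model -/

variable (R S : ((ConnectedPart (BTemp (Compat 3 thetaShear)))ᵒᵖ ⥤ CommMonCat.{0}) → Prop)

/-- **THE LEVEL-WISE `μ_K`-SATURATION LAW `hsat` HOLDS at the fourth model** (abc-iut-w6-d037's binder, verbatim): for `K ∣ N_m`, every object
over a covering of level `≥ m` all of whose stabilisers have trivial index-`m` character coordinate is `μ_K`-saturated — MU-TORSION (M3) at
the fixed value `ζ_{N_m}` of order `N_m`. [cite: MochizukiEtTh2009, Def 4.1 (iv) p.87] -/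
theorem levelSaturation (K : ℕ+) (m : ℕ) (A : (ThetaTwistTowerTempered.temperedFrobenioid R S).category) (hK : (K : ℕ) ∣ (N m : ℕ))
    (hm : m ≤ lvlC 3 thetaShear A.base)
    (hχ : ∀ (s : A.base.obj.obj.V) (g : Compat 3 thetaShear), A.base.obj.obj.ρ g s = s → (g : Grp 3 thetaShear).right.1 m = 1) :
    (ThetaTwistTowerTempered.temperedFrobenioid R S).IsMuSaturated A K := by
  obtain ⟨s₀⟩ := (isConnectedGSet_gset A.base).1
  refine isMuSaturated_of_fixed R S A s₀
    ⟨zeta (TateTowerKummerTwist.MuN (lvlC 3 thetaShear A.base))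
      (Multiplicative.ofAdd ((((N (lvlC 3 thetaShear A.base) : ℕ+) : ℕ) / ((N m : ℕ+) : ℕ) : ℕ) : ZMod (N (lvlC 3 thetaShear A.base)))),
      rfl⟩ rfl (fun g hg => actFn_zetaImage_eq_of_right_eq_one hm g (hχ s₀ g hg)) K ?_
  change (K : ℕ) ∣ orderOf (Multiplicative.ofAdd _)
  rw [orderOf_zetaImage hm]
  exact hK

/-- `hsat` in the producer-chosen-threshold form (`m := K`, `K ∣ (K+1)! = N_K`). [cite: MochizukiEtTh2009, Def 4.1 (iv) p.87] -/
theorem levelSaturation' (K : ℕ+) : ∃ m : ℕ, ∀ A : (ThetaTwistTowerTempered.temperedFrobenioid R S).category,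
    m ≤ lvlC 3 thetaShear A.base →
    (∀ (s : A.base.obj.obj.V) (g : Compat 3 thetaShear), A.base.obj.obj.ρ g s = s → (g : Grp 3 thetaShear).right.1 m = 1) →
      (ThetaTwistTowerTempered.temperedFrobenioid R S).IsMuSaturated A K :=
  ⟨K, fun A hm hχ => levelSaturation R S K K A (Nat.dvd_factorial K.pos (Nat.le_succ _)) hm hχ⟩

/-! ## §3 The knit: [EtTh] Prop. 4.2 (iii) AS TYPED at the canonical §4 model over the fourth tower model -/

variable {K : Type 1} [Field K] (X : SemiGraphs.TemperedArithmeticGroup.{1} K)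
  (gS : ∀ A : ConnectedPart (BTemp (Compat 3 thetaShear)),
    IsGaloisObj ((ThetaTwistTowerTempered.temperedFrobenioid R S).base.obj A).obj → (X.Pi →* Aut A))
  (gSs : ∀ (A : ConnectedPart (BTemp (Compat 3 thetaShear)))
    (h : IsGaloisObj ((ThetaTwistTowerTempered.temperedFrobenioid R S).base.obj A).obj), Function.Surjective (gS A h))
  (A₀ : (ThetaTwistTowerTempered.temperedFrobenioid R S).category)
  (hA₀ : PreFrobenioid.IsFrobeniusTrivial (ThetaTwistTowerTempered.temperedFrobenioid R S).toElem A₀)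
  (hA₀' : IsGaloisObj ((ThetaTwistTowerTempered.temperedFrobenioid R S).base.obj A₀.base).obj)

/-- **[EtTh] Prop. 4.2 (iii) AS TYPED at the canonical §4 model `mkOfModelCanonical X tf …` over the FOURTH tower model `tf`, for every
free tempered arithmetic group `X`, Galois action `gS` and Frobenius-trivial Galois-based anchor `A₀`** — every law of abc-iut-w4-d044 /
abc-iut-w6-d037's reduction (`Φ` divisorial, coprime pull-backs, the E2 root law, the refinement law `hE` via LEVEL-WISE SATURATION) is a
THEOREM here; the one displayed binder is the Def. 4.1 (ii) naturality datum `hS` of the free Galois action.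
[cite: MochizukiEtTh2009, Prop 4.2 (iii) p.88] -/
theorem prop42_iii
    (hS : ∀ ⦃A B : ConnectedPart (BTemp (Compat 3 thetaShear))⦄
      (hA : IsGaloisObj ((ThetaTwistTowerTempered.temperedFrobenioid R S).base.obj A).obj)
      (hB : IsGaloisObj ((ThetaTwistTowerTempered.temperedFrobenioid R S).base.obj B).obj) (b : B ⟶ A),
      ∃ c : X.Pi, ∀ g : X.Pi, (gS B hB g).hom ≫ b = b ≫ (gS A hA (c * g * c⁻¹)).hom) :
    (BiKummerSetting.mkOfModelCanonical X (ThetaTwistTowerTempered.temperedFrobenioid R S) (monoidType_eq R S) (hP R S)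
        (fun A => IsGaloisObj ((ThetaTwistTowerTempered.temperedFrobenioid R S).base.obj A).obj) gS gSs
        (fun _ _ _ => True) A₀ hA₀ hA₀').Prop42_iii
      (fun {_ _} φ x => (ThetaTwistTowerTempered.temperedFrobenioid R S).pullFracModel φ x) :=
  prop42_iii_of_levelSaturation R S X gS gSs A₀ hA₀ hA₀' (levelSaturation R S) hS

end ThetaTwistTowerTempered

end Literature.AnabelianGeometry.EtaleTheta

end
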